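import Literature.MathematicalPhysics.QuantumLattice.HubbardScaleReportCT

/-!
# Crux `SeededBrokenRegimeBoseFermiPinned` (stmt-HubbardSuperconductivity-14047), line `seed-strength-flow` — stub `stub_legKernelNormSingle` (N3)

WHAT. Salmhofer's leg-weighted `L¹–L^∞` kernel norm
(`legKernelNorm`, `Literature/MathematicalPhysics/QuantumLattice/HubbardScaleReport.lean`, §3) in
positive degree `m + 1` is the finite supremum over a distinguished leg `p` and its label `x` of
`ε ^ m · Σ_{X : X p = x} (∏_q wt (X q)) · ‖K X‖` (`legKernelNorm_succ`).  For nonnegative weights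
`wt` and `ε ≥ 0` every summand is nonnegative, so a SINGLE weighted term
`ε ^ m · (∏_q wt (X q)) · ‖K X‖` is dominated by the norm: take `p := 0`, `x := X 0`, and bound the
term by the sum over the fibre `{X' : X' 0 = X 0}`, which contains `X`.

SOURCE: folklore (one nonnegative summand is at most the sum; a value is at most a finite supremum).

The file proves the generic single-term bound `LegKernelNormSingle.single_le_legKernelNorm` over any
`RCLike` scalar field and any finite label type, then the registered stub (labels `HubbardFieldIdx L M`,
scalars `ℂ`).
-/

set_option linter.dupNamespace false -- Summit.<S>.<S> doubles the summit name (tree convention)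

namespace Summit.HubbardSuperconductivity.HubbardSuperconductivity.Theorems.AposterioriCapRgSeededBrokenRegimeBoseFermiPinned

open Literature.MathematicalPhysics.QuantumLattice Literature.Probability.LatticeModels GrassmannAlgebra

namespace LegKernelNormSingle

variable {𝕜 : Type*} [RCLike 𝕜] {Γ : Type*} [Fintype Γ] [DecidableEq Γ]

/-- A single weighted term is dominated by the leg-weighted `L¹–L^∞` norm (generic labels and
scalars): `ε ^ m · (∏_q wt (X q)) · ‖K X‖ ≤ legKernelNorm wt ε (m + 1) K` for `ε ≥ 0` and nonnegative
weights — the term is one nonnegative summand of the fibre sum at leg `p = 0`, label `x = X 0`.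
[folklore] -/
theorem single_le_legKernelNorm {wt : Γ → ℝ} (hwt : ∀ Y, 0 ≤ wt Y) {ε : ℝ} (hε : 0 ≤ ε) (m : ℕ)
    (K : (Fin (m + 1) → Γ) → 𝕜) (X : Fin (m + 1) → Γ) :
    ε ^ m * ((∏ q, wt (X q)) * ‖K X‖) ≤ legKernelNorm wt ε (m + 1) K := by
  rw [legKernelNorm_succ]
  refine le_ciSup_of_le (Finite.bddAbove_range _) (0 : Fin (m + 1))
    (le_ciSup_of_le (Finite.bddAbove_range _) (X 0) ?_)
  refine mul_le_mul_of_nonneg_left ?_ (pow_nonneg hε m)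
  exact Finset.single_le_sum (f := fun X' : Fin (m + 1) → Γ => (∏ q, wt (X' q)) * ‖K X'‖)
    (fun X' _ => mul_nonneg (Finset.prod_nonneg fun q _ => hwt _) (norm_nonneg _))
    (Finset.mem_filter.2 ⟨Finset.mem_univ _, rfl⟩)

end LegKernelNormSingle

/-! ### N3 -/

/-- **N3 (`LegKernelNormSingle`)**: one weighted term is dominated by the leg-weighted `L¹–L^∞` norm:
`ε^m · ∏_q wt(X_q) · ‖K X‖ ≤ ‖K‖_{wt,ε}` for nonnegative weights (`m + 1` legs). [folklore] -/
theorem stub_legKernelNormSingle :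
    ∀ (L M : ℕ) [NeZero L] (wt : HubbardFieldIdx L M → ℝ) (ε : ℝ) (m : ℕ)
      (K : (Fin (m + 1) → HubbardFieldIdx L M) → ℂ) (X : Fin (m + 1) → HubbardFieldIdx L M),
        0 ≤ ε → (∀ Y, 0 ≤ wt Y) → ε ^ m * ((∏ q, wt (X q)) * ‖K X‖) ≤ legKernelNorm wt ε (m + 1) K := by
  intro L M _ wt ε m K X hε hwt
  exact LegKernelNormSingle.single_le_legKernelNorm hwt hε m K X

end Summit.HubbardSuperconductivity.HubbardSuperconductivity.Theorems.AposterioriCapRgSeededBrokenRegimeBoseFermiPinned
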